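import Literature.Probability.RandomPlanarGeometry.SLEBoundaryHittingProofs
import HarnessLib

/-!
# An interval swallowed at once is sealed off from the Loewner domain

Trunk T-STOCH. A deterministic plane-topology step in the proof of transience of the SLE trace
for `4 < κ < 8` (Rohde–Schramm (2005), Lemma 7.3, p. 910: "a.s. there is some (random) `ε > 0`
such that the interval `[γ(t₀) - ε, γ(t₀)]` is swallowed all at once; i.e.
`∃ t > t₀, [γ(t₀) - ε, γ(t₀)] ⊆ Kₜ` but `[γ(t₀) - ε, γ(t₀)] ∩ K_s = ∅` for `s < t`").

For a chordal Loewner chain generated by a curve `γ` with continuous driving function started at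
`0`: if two negative real points `a' < b' < 0` are swallowed at the same finite time `T`
(`T_{a'} = T_{b'} = T`), then every real `w ∈ (a', b')` has a neighbourhood whose upper half lies
in the hull `K_T` (`Loewner.IsGeneratedByCurve.exists_ball_subset_hull_of_swallowingTime_eq`,
**proved**), so `w ∉ cl H_s` for all `s ≥ T` (`…notMem_closure_domain_of_swallowingTime_eq`,
**proved**). Indeed swallowing of real points is hitting of real rays
(`Loewner.swallowingTime_ofReal_eq_firstHit_of_ne`): `γ(T) ≤ a'` while `γ[0, T)` misses
`(-∞, b']`, so the continuum `γ[0, T] ∌ w` joins `γ(T) < w` to `γ(0) = 0 > w` in `ℍ̄` and the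
enclosure theorem (`JordanCurveTheorem.exists_isBounded_connectedComponentIn`, from the Jordan
curve theorem, both proved in `Literature/Topology/PlaneTopology`) applies.

## References

* S. Rohde, O. Schramm, *Basic properties of SLE*, Ann. of Math. 161 (2005), Lemma 7.3.
* G. F. Lawler, *Conformally Invariant Processes in the Plane*, AMS (2005), Rem. 6.6, proof of
  Prop. 6.10.
-/

noncomputable section

open Set Filter Topology Metric Complex
open UpperHalfPlane (upperHalfPlaneSet isOpen_upperHalfPlaneSet)
open scoped NNReal

namespace Literature.Probability.RandomPlanarGeometry

namespace Loewner

variable {W : ℝ≥0 → ℝ} {γ : ℝ≥0 → ℂ}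

/-- At a finite swallowing time `T = T_x` of a real point `x ≠ 0`, the curve is on the real ray
from `x` away from `0`: `γ(T) ∈ realRay x`. [cite: Lawler2005, Rem. 6.6] -/
theorem IsGeneratedByCurve.apply_mem_realRay_of_swallowingTime_eq (hγ : IsGeneratedByCurve W γ)
    (hW : Continuous W) (hW0 : W 0 = 0) {x : ℝ} (hx : x ≠ 0) {T : ℝ≥0}
    (hT : swallowingTime W x = T) : γ T ∈ realRay x := by
  rw [swallowingTime_ofReal_eq_firstHit_of_ne hW hW0 hγ hx] at hT
  obtain ⟨t₀, ht₀, hmem⟩ := exists_firstHit_eq_coe hγ.continuous (isClosed_realRay x)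
    (by rw [hT]; exact WithTop.coe_ne_top)
  rw [hT] at ht₀
  rwa [WithTop.coe_eq_coe.1 ht₀]

/-- Strictly before the swallowing time of a real point `x ≠ 0`, the curve is off the real ray
from `x`. [cite: Lawler2005, Rem. 6.6] -/
theorem IsGeneratedByCurve.apply_notMem_realRay_of_lt_swallowingTime (hγ : IsGeneratedByCurve W γ)
    (hW : Continuous W) (hW0 : W 0 = 0) {x : ℝ} (hx : x ≠ 0) {s : ℝ≥0}
    (hs : (s : WithTop ℝ≥0) < swallowingTime W x) : γ s ∉ realRay x := by
  rw [swallowingTime_ofReal_eq_firstHit_of_ne hW hW0 hγ hx] at hs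
  exact notMem_of_lt_firstHit hs

/-- **An interval swallowed at once is sealed.** If `a' < b' < 0` are swallowed at the same finite
time `T`, then every real `w ∈ (a', b')` has a ball whose upper half lies in `K_T`: `γ(T) ≤ a'`
(`γ(T) ∈ realRay a'`), `γ[0, T)` misses `realRay b' ∋ w`, so `γ[0, T] ∌ w` joins the real points
`γ(T) < w < 0 = γ(0)` inside `ℍ̄`, and the enclosure theorem bounds the component in
`ℍ ∖ γ[0, T]` of every point of `ℍ` near `w`. [cite: RohdeSchramm2005, Lemma 7.3] -/
theorem IsGeneratedByCurve.exists_ball_subset_hull_of_swallowingTime_eq (hγ : IsGeneratedByCurve W γ)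
    (hW : Continuous W) (hW0 : W 0 = 0) {a' b' w : ℝ} (haw : a' < w) (hwb : w < b') (hb : b' < 0)
    {T : ℝ≥0} (hTa : swallowingTime W a' = T) (hTb : swallowingTime W b' = T) :
    ∃ r > 0, ∀ z ∈ ball (w : ℂ) r, 0 < z.im → z ∈ hull W T := by
  have ha0 : a' ≠ 0 := by rintro rfl; linarith
  have hb0 : b' ≠ 0 := hb.ne
  have hγ0 : γ 0 = 0 := by rw [hγ.apply_zero, hW0]; simp
  -- `γ(T)` is real, `≤ a'`
  have hT := hγ.apply_mem_realRay_of_swallowingTime_eq hW hW0 ha0 hTa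
  rw [mem_realRay_iff] at hT
  obtain ⟨hTim, -, hTre⟩ := hT
  have hTre : (γ T).re ≤ a' := hTre (by linarith)
  -- `w ∉ γ[0, T]`
  set C : Set ℂ := γ '' Icc 0 T with hC
  have hwC : ((w : ℝ) : ℂ) ∉ C := by
    rintro ⟨s, hs, hsw⟩
    rcases hs.2.eq_or_lt with rfl | hsT
    · have : (γ s).re = w := by rw [hsw]; simp
      linarith
    · have hlt : (s : WithTop ℝ≥0) < swallowingTime W b' := by
        rw [hTb]; exact WithTop.coe_lt_coe.2 hsT
      refine hγ.apply_notMem_realRay_of_lt_swallowingTime hW hW0 hb0 hlt ?_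
      rw [hsw, mem_realRay_iff]
      exact ⟨by simp, fun h ↦ absurd h (not_lt.2 hb.le), fun _ ↦ by simp; linarith⟩
  have hCc : IsCompact C := isCompact_Icc.image hγ.continuous
  have hCconn : IsPreconnected C := isPreconnected_Icc.image _ hγ.continuous.continuousOn
  have hCim : ∀ z ∈ C, 0 ≤ z.im := by
    rintro _ ⟨v, -, rfl⟩
    exact hγ.im_nonneg v
  have haC : (((γ T).re : ℝ) : ℂ) ∈ C :=
    ⟨T, ⟨zero_le, le_rfl⟩, Complex.ext (by simp) (by simp [hTim])⟩
  have hbC : (((0 : ℝ) : ℝ) : ℂ) ∈ C := ⟨0, ⟨le_rfl, zero_le⟩, by simp [hγ0]⟩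
  obtain ⟨r, hr, henc⟩ :=
    Literature.Topology.PlaneTopology.JordanCurveTheorem_holds.exists_isBounded_connectedComponentIn
      hCc hCconn hCim (show (γ T).re < w by linarith) (show w < (0 : ℝ) by linarith) haC hbC hwC
  refine ⟨r, hr, fun z hz hzim ↦ ?_⟩
  by_cases hzγ : z ∈ γ '' Icc 0 T
  · exact hγ.mem_hull_of_mem_image hzim hzγ
  · exact (hγ.mem_hull_iff hzim hzγ).2 (henc z hz hzim)

/-- **Consequently such `w` is off the closure of every later domain**: `w ∉ cl H_s` for `T ≤ s`.
[cite: RohdeSchramm2005, Lemma 7.3] -/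
theorem IsGeneratedByCurve.notMem_closure_domain_of_swallowingTime_eq (hγ : IsGeneratedByCurve W γ)
    (hW : Continuous W) (hW0 : W 0 = 0) {a' b' w : ℝ} (haw : a' < w) (hwb : w < b') (hb : b' < 0)
    {T s : ℝ≥0} (hTa : swallowingTime W a' = T) (hTb : swallowingTime W b' = T) (hTs : T ≤ s) :
    (w : ℂ) ∉ closure (domain W s) := by
  obtain ⟨r, hr, hball⟩ := hγ.exists_ball_subset_hull_of_swallowingTime_eq hW hW0 haw hwb hb hTa hTb
  rw [Metric.mem_closure_iff]
  push Not
  refine ⟨r, hr, fun z hz ↦ ?_⟩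
  by_contra hlt
  rw [not_le] at hlt
  have hzb : z ∈ ball (w : ℂ) r := by rw [mem_ball, dist_comm]; exact hlt
  have hzH : 0 < z.im := domain_subset W s hz
  exact hz.2 (hull_mono W hTs (hball z hzb hzH))

end Loewner

end Literature.Probability.RandomPlanarGeometry
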